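import Summits.QuantumFields.YangMills.Theorems.LuscherReductionTwistedTraceScalingFloorMassScales
import Literature.NumberTheory.LFunctions.NicolasOmega
import HarnessLib

/-!
# The k = 0 FLOOR at polynomial scales, part 3: ★★★★ `VacuumFloorAt L Λ_id (K·β^{−1/10})` — the vacuum floor with the IDEAL normalisation — and
# COARSE-UPPER(L) ⇐ normalisation comparison + INNER (lane A of S-BASE, crux `TwistedTraceScaling` stmt-QuantumFields-20203; design note
# `pub/ym-fleet/ym-luscher-20007-p1/COARSE-DESIGN.md` §18)

With `Λ_id(β) = (2π²)^{−|E|} e^{2β|E|} √(π/β)^{3|E|} e^{−6·toronZPE L (1/2) 0 0}` (`idealFloorLevel`: free link normalisation × the vacuum's harmonic zero-point factor):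
* §1 ★★★★ `vacuumFloorAt_ideal` — for `L ≥ 2`: `∃ K, VacuumFloorAt L (idealFloorLevel L) (fun β ↦ K·β^{−1/10})`, from `levelValue_zero_ge_floor` (`…FloorMass`) at the scales
  `μ = (2−2cos(2π/L))/8`, `τ = β^{−1/3}`, `ρ = β^{−12/25}`, `γ = β^{7/10}`, `s = β^{−1/2}`, `δ = 1 − (√(1+ρ²))⁻¹`, with the error exponents of `…FloorScales`, the mass and
  tail of `…FloorMassScales`, and the super-polynomial tails `e^{−2β^{1/30}}`, `e^{−β^{1/25}/2}` against `floorMass⁻¹ = O(β^{3|E|/2})`;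
* §2 ★★★ `valleyFloorAt_of_idealCmp_pow` / `coarseNoIntruderAt_of_idealCmp_pow` — hence, for `0 < p < 1/10`, `4p < q < 8/9`, `0 < r < 1/2`, `0 < m`, `2r < q − m/2`:
  COARSE-UPPER(L) ⇐ the NORMALISATION COMPARISON `riccatiN L β (β^{−r}) (2β^{−q}) (β^{−m}) · e^{−6Z₀(1/2)} ≤ Λ_id(β) · e^{εβ^{−p}}` (every `ε > 0`, eventually; pure real
  asymptotics of lane B's explicit prefactor, design note §17.7) + `InnerNoIntruderOneOrbitAt L (β^{−p})` (C4).  The k = 0 FLOOR is PROVED; lane B's (H-SUB)+(MASS)@k=0 is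
  no longer on this path.
HONEST FRAMING: real asymptotics + bookkeeping for a stub lane of a child of the CONDITIONAL reduction route (femto rung R2b1); the normalisation comparison and INNER are OPEN;
not infinite volume, not a gap, not Clay.

## References
* M. Lüscher, Nucl. Phys. B219 (1983) 233, §3. [Luscher1983]
* M. Lüscher, G. Münster, Nucl. Phys. B232 (1984) 445, §2. [LuscherMunster1984]
-/

set_option autoImplicit false

noncomputable section

open MeasureTheory Real Finset
open scoped BigOperators
open Literature.MathematicalPhysics.QuantumFieldTheory
open Literature.MathematicalPhysics.QuantumLattice

namespace Summit.QuantumFields.YangMills.Theorems.FemtoTransferGap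

open TwoLattice TwoLattice.Toron TwoLattice.Cov TwoLattice.Stiff TwoLattice.Harm TwoLattice.GnChart TwoLattice.Flat

variable {L : ℕ} [NeZero L]

/-! ## §1 ★★★★ The vacuum floor with the ideal normalisation -/

variable (L) in
/-- **The ideal floor level** `Λ_id(β) = (2π²)^{−|E|}·e^{2β|E|}·(√(π/β)^{3|E|}·e^{−6·toronZPE L (1/2) 0 0})`: free link normalisation of one transfer step times the harmonic
zero-point factor of the vacuum's stiff modes. [cite: Luscher1983, §3] -/
def idealFloorLevel (β : ℝ) : ℝ :=
  ((2 * π ^ 2)⁻¹) ^ Fintype.card (Edge 3 L) * Real.exp (2 * β) ^ Fintype.card (Edge 3 L) *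
    (Real.sqrt (Real.pi / β) ^ (Fintype.card (Edge 3 L) * 3) * Real.exp (-(6 * toronZPE L (1 / 2) 0 0)))

/-- `Λ_id ≥ 0`. [folklore] -/
theorem idealFloorLevel_nonneg (β : ℝ) : 0 ≤ idealFloorLevel L β := by unfold idealFloorLevel; positivity
set_option maxHeartbeats 400000 in
/-- ★★★★ **THE VACUUM FLOOR WITH THE IDEAL NORMALISATION** (`L ≥ 2`): `∃ K, VacuumFloorAt L Λ_id (K·β^{−1/10})`, i.e. eventually
`λ₀(β, L) ≥ (2π²)^{−|E|} e^{2β|E|} √(π/β)^{3|E|} e^{−6Z₀(1/2)} · e^{−Kβ^{−1/10}}`. [cite: Luscher1983, §3] -/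
theorem vacuumFloorAt_ideal (hL : 2 ≤ L) : ∃ K : ℝ, VacuumFloorAt L (idealFloorLevel L) (fun β => K * β ^ (-(1 / 10 : ℝ))) := by
  -- the soft cap
  set g₀ : ℝ := 2 - 2 * Real.cos (2 * Real.pi / L) with hg₀
  have hg₀pos : 0 < g₀ := gap_pos L hL
  set μ : ℝ := g₀ / 8 with hμdef
  have hμ : 0 < μ := by positivity
  -- lattice constants
  set N : ℝ := (Fintype.card (Plaquette 3 L × Fin 3) : ℝ) with hN
  set nE : ℕ := Fintype.card (Edge 3 L) with hnE
  set Cq : ℝ := 100 * Fintype.card (Plaquette 3 L × Fin 3) + 729945 * Fintype.card (Plaquette 3 L) with hCq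
  have hCq0 : 0 ≤ Cq := by positivity
  -- the error constants
  obtain ⟨KE, hKE0, hKE⟩ := riccatiTrialErr_pow_le (L := L) hμ
  obtain ⟨KS, hKS0, hKS⟩ := stepErr_pow_le (L := L)
  obtain ⟨KD, hKD0, hKD⟩ := floorDefect_pow_le (L := L) hμ
  obtain ⟨KG, hKG0, hKG⟩ := gammaMove_pow_le (L := L)
  obtain ⟨cM, hcM0, hcM⟩ := floorMass_pow_ge (L := L) hμ
  set KA : ℝ := KE + KG + KD with hKA
  have hKA0 : 0 ≤ KA := by positivity
  set K₁ : ℝ := 2 * nE + KS + KA with hK₁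
  set CT : ℝ := Real.exp KA * (2 : ℝ) ^ (((nE * 3 : ℕ) : ℝ) / 2) * Real.exp (6 * toronZPE L (1 / 2) 0 0) with hCT
  have hCT0 : 0 ≤ CT := by positivity
  set K₂ : ℝ := cM⁻¹ * (Real.exp (-4) + CT * Real.exp (-4)) with hK₂
  have hK₂0 : 0 ≤ K₂ := by positivity
  -- thresholds
  set u₀ : ℝ := min (1 / 100) (min (1 / (16 * (Cq + 1))) (Real.sqrt μ / (504 * Real.sqrt N + 1))) with hu₀
  have hu₀pos : 0 < u₀ := by
    refine lt_min (by norm_num) (lt_min (by positivity) (by positivity))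
  obtain ⟨βa, hβa⟩ := rpow_mul_exp_neg_le_eventually (a := 1 / 30) (by norm_num) ((3 * nE : ℕ) * (1 / 2) + 1 / 10)
  obtain ⟨βb, hβb⟩ := rpow_mul_exp_neg_le_eventually (a := 1 / 25) (by norm_num) ((3 * nE : ℕ) * (1 / 2) + 1 / 10)
  refine ⟨K₁ + 2 * K₂, max 1 (max ((u₀⁻¹) ^ 3) (max βa (max βb ((2 * K₂ + 1) ^ (10 : ℕ))))), fun β hβ => ?_⟩
  have hβ1 : 1 ≤ β := (le_max_left _ _).trans hβ
  have hβ0 : 0 < β := lt_of_lt_of_le one_pos hβ1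
  have hβu : (u₀⁻¹) ^ 3 ≤ β := ((le_max_left _ _).trans (le_max_right _ _)).trans hβ
  have hβa' : βa ≤ β := (((le_max_left _ _).trans (le_max_right _ _)).trans (le_max_right _ _)).trans hβ
  have hβb' : βb ≤ β := ((((le_max_left _ _).trans (le_max_right _ _)).trans (le_max_right _ _)).trans (le_max_right _ _)).trans hβ
  have hβK : (2 * K₂ + 1) ^ (10 : ℕ) ≤ β :=
    ((((le_max_right _ _).trans (le_max_right _ _)).trans (le_max_right _ _)).trans (le_max_right _ _)).trans hβ
  -- the scales
  set u : ℝ := β ^ (-(1 / 3 : ℝ)) with hu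
  set v : ℝ := β ^ (-(12 / 25 : ℝ)) with hv
  set γ : ℝ := β ^ (7 / 10 : ℝ) with hγ
  set s : ℝ := β ^ (-(1 / 2 : ℝ)) with hs
  set δ : ℝ := 1 - (Real.sqrt (1 + v ^ 2))⁻¹ with hδ
  obtain ⟨hu0, hu1, hv0, hvu, hv2, -, -, -, -, hγu2, hβv2, -, -, -, -⟩ := scales_basic hβ1 hu hv
  have hγ0 : 0 ≤ γ := (Real.rpow_pos_of_pos hβ0 _).le
  have hs0 : 0 < s := Real.rpow_pos_of_pos hβ0 _
  have hsu : s ≤ u := by rw [hs, hu]; exact Real.rpow_le_rpow_of_exponent_le hβ1 (by norm_num)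
  -- `u ≤ u₀`
  have huu₀ : u ≤ u₀ := rpow_neg_third_le_of_le hu₀pos hβu
  have hu100 : u ≤ 1 / 100 := huu₀.trans (min_le_left _ _)
  have hu16 : u ≤ 1 / (16 * (Cq + 1)) := huu₀.trans ((min_le_right _ _).trans (min_le_left _ _))
  have hugap : u ≤ Real.sqrt μ / (504 * Real.sqrt N + 1) := huu₀.trans ((min_le_right _ _).trans (min_le_right _ _))
  -- hypotheses of the floor
  have hτ : u ≤ 1 / 30 := hu100.trans (by norm_num)
  have hρ : v ≤ 1 / 100 := hvu.trans hu100
  have hss : s ≤ 1 / 30 := hsu.trans hτ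
  have hδ1 : δ < 1 := by
    rw [hδ]; have : 0 < (Real.sqrt (1 + v ^ 2))⁻¹ := by positivity
    linarith only [this]
  have hρδ : (1 - δ) ^ 2 * (1 + v ^ 2) ≤ 1 := by
    rw [hδ, sub_sub_cancel, inv_pow, Real.sq_sqrt (by positivity), inv_mul_cancel₀ (by positivity)]
  have hσ : tubeSigma L u ≤ 1 / 16 := by
    have h1 := tubeSigma_le_sq (L := L) hu0.le hu1
    rw [← hCq] at h1
    have hu2 : u ^ 2 ≤ u := by
      have := mul_le_mul_of_nonneg_left hu1 hu0.le
      calc u ^ 2 = u * u := by ring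
        _ ≤ u * 1 := this
        _ = u := mul_one u
    have h2 : Cq * u ^ 2 ≤ (Cq + 1) * u := by
      have := mul_le_mul_of_nonneg_left hu2 hCq0
      linarith only [this, hu0.le]
    have h3 : (Cq + 1) * u ≤ 1 / 16 := by
      have h4 := hu16
      rw [le_div_iff₀ (by positivity)] at h4
      linarith only [h4]
    linarith only [h1, h2, h3]
  have hgap : 2 * (Real.sqrt μ + 504 * u * Real.sqrt N) ^ 2 ≤ g₀ := by
    have h1 : 504 * u * Real.sqrt N ≤ Real.sqrt μ := by
      have h4 := hugap
      rw [le_div_iff₀ (by positivity)] at h4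
      have h5 : u * (504 * Real.sqrt N + 1) = 504 * u * Real.sqrt N + u := by ring
      rw [h5] at h4
      linarith only [h4, hu0.le]
    have h2 : (Real.sqrt μ + 504 * u * Real.sqrt N) ^ 2 ≤ (2 * Real.sqrt μ) ^ 2 :=
      pow_le_pow_left₀ (by positivity) (by linarith only [h1]) 2
    have h3 : (2 * Real.sqrt μ) ^ 2 = 4 * μ := by rw [mul_pow, Real.sq_sqrt hμ.le]; norm_num
    rw [h3] at h2
    have : 8 * μ = g₀ := by rw [hμdef]; ring
    linarith only [h2, this]
  -- ### the floor in pre-asymptotic form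
  have hfloor := levelValue_zero_ge_floor hL hβ0 hμ hγ0 hδ1 hv0.le hρ hρδ hu0.le hτ hσ hgap hs0 hss
  -- ### the pieces
  set E : ℝ := riccatiTrialErr L β μ v (tubeSigma L u) with hEdef
  set γ' : ℝ := γ * (2 * u * chartMove L v + chartMove L v ^ 2) with hγ'
  set D : ℝ := floorDefect L β μ u with hDdef
  set SU : ℝ := β / 2 * (stepErrUp v (tubeSigma L u) (Fintype.card (Plaquette 3 L × Fin 3)) + chartErr v (tubeSigma L u) (Fintype.card (Plaquette 3 L × Fin 3)))
    with hSU
  set Q : ℝ := Real.sqrt (Real.pi / β) ^ (nE * 3) * Real.exp (-(6 * toronZPE L (1 / 2) 0 0)) with hQ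
  set A : ℝ := Real.exp (-E) * Real.exp (-γ') * Real.exp (-D) with hA
  set P : ℝ := (((1 + v ^ 2)⁻¹) ^ 2) ^ nE with hP
  set M : ℝ := floorMass L β μ γ s with hM
  set T : ℝ := floorTail L β v with hT
  set e₁ : ℝ := Real.exp (-(2 * γ * u ^ 2)) with he₁
  have hQpos : 0 < Q := by rw [hQ]; exact mul_pos (pow_pos (Real.sqrt_pos.2 (by positivity)) _) (Real.exp_pos _)
  have hApos : 0 < A := by positivity
  have hMpos : 0 < M := by rw [hM]; exact floorMass_pos β μ γ hs0
  -- bounds on the exponents (β ≥ 1)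
  have hE : E ≤ KE * β ^ (-(1 / 10 : ℝ)) := hKE β hβ1
  have hS : SU ≤ KS * β ^ (-(1 / 10 : ℝ)) := hKS β hβ1
  have hD : D ≤ KD * β ^ (-(1 / 10 : ℝ)) := hKD β hβ1
  have hG : γ' ≤ KG * β ^ (-(1 / 10 : ℝ)) := hKG β hβ1
  have hβp : β ^ (-(1 / 10 : ℝ)) ≤ 1 := Real.rpow_le_one_of_one_le_of_nonpos hβ1 (by norm_num)
  have hβp0 : 0 < β ^ (-(1 / 10 : ℝ)) := Real.rpow_pos_of_pos hβ0 _
  -- `floorCK = Λ_id / Q · P · e^{−SU}` and `m = Λ_id · P · e^{−SU} · A`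
  have hCK : floorCK L β v u = ((2 * π ^ 2)⁻¹) ^ nE * Real.exp (2 * β) ^ nE * P * Real.exp (-SU) := by
    rw [floorCK, hP, hSU, mul_pow, neg_mul, ← hnE]; ring_nf
  have hΛ : idealFloorLevel L β = ((2 * π ^ 2)⁻¹) ^ nE * Real.exp (2 * β) ^ nE * Q := by rw [idealFloorLevel, hQ, hnE]
  -- ### the pre-asymptotic floor as `m(1 − B) ≤ λ₀`
  set m : ℝ := floorCK L β v u * (A * Q) with hm
  set B : ℝ := (e₁ + T / (A * Q)) / M with hB
  have hm_eq : m = idealFloorLevel L β * (P * Real.exp (-SU) * A) := by rw [hm, hCK, hΛ]; ring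
  have hfloor' : m * (1 - B) ≤ levelValue su2Rep L β 0 := by
    have h1 : floorCK L β v u * (Real.exp (-E) * Real.exp (-γ') * Real.exp (-D) * Q) = m := rfl
    have h2 : m * (1 - B) = m - (m * e₁ + floorCK L β v u * T) / M := by
      rw [hB, hm]; field_simp
    rw [h2, ← h1]
    exact hfloor
  -- ### `m ≥ Λ_id e^{−tol₁}`
  have hPge : Real.exp (-(2 * nE * v ^ 2)) ≤ P := by
    have h1 : Real.exp (-(v ^ 2)) ≤ (1 + v ^ 2)⁻¹ := exp_neg_le_inv_one_add (sq_nonneg v)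
    have h2 : Real.exp (-(v ^ 2)) ^ 2 ≤ ((1 + v ^ 2)⁻¹) ^ 2 := pow_le_pow_left₀ (Real.exp_pos _).le h1 2
    have h3 := pow_le_pow_left₀ (by positivity) h2 nE
    have h4 : (Real.exp (-(v ^ 2)) ^ 2) ^ nE = Real.exp (-(2 * nE * v ^ 2)) := by
      rw [← pow_mul, ← Real.exp_nat_mul]
      congr 1
      push_cast
      ring
    rw [← h4]
    exact h3
  have hv2le : v ^ 2 ≤ β ^ (-(1 / 10 : ℝ)) := by
    have h1 : v ^ 2 = β ^ (-(24 / 25 : ℝ)) := by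
      rw [hv, ← Real.rpow_natCast, ← Real.rpow_mul hβ0.le]; norm_num
    rw [h1]
    exact Real.rpow_le_rpow_of_exponent_le hβ1 (by norm_num)
  have htol₁ : Real.exp (-(K₁ * β ^ (-(1 / 10 : ℝ)))) ≤ P * Real.exp (-SU) * A := by
    have h1 : Real.exp (-(K₁ * β ^ (-(1 / 10 : ℝ)))) ≤ Real.exp (-(2 * nE * v ^ 2)) * Real.exp (-SU) * A := by
      rw [hA, ← Real.exp_add, ← Real.exp_add, ← Real.exp_add, ← Real.exp_add, Real.exp_le_exp, hK₁, hKA]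
      have := mul_le_mul_of_nonneg_left hv2le (show (0:ℝ) ≤ 2 * nE by positivity)
      have hex : (2 * ↑nE + KS + (KE + KG + KD)) * β ^ (-(1 / 10 : ℝ)) =
          2 * ↑nE * β ^ (-(1 / 10 : ℝ)) + KS * β ^ (-(1 / 10 : ℝ)) + KE * β ^ (-(1 / 10 : ℝ)) + KG * β ^ (-(1 / 10 : ℝ)) + KD * β ^ (-(1 / 10 : ℝ)) := by
        ring
      rw [hex]
      linarith only [this, hE, hS, hD, hG]
    exact h1.trans (mul_le_mul_of_nonneg_right (mul_le_mul_of_nonneg_right hPge (Real.exp_pos _).le) hApos.le)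
  -- ### `B ≤ K₂ β^{−1/10} ≤ 1/2`
  have hAge : Real.exp (-KA) ≤ A := by
    rw [hA, ← Real.exp_add, ← Real.exp_add, Real.exp_le_exp, hKA]
    have h1 := mul_le_of_le_one_right hKE0 hβp
    have h2 := mul_le_of_le_one_right hKG0 hβp
    have h3 := mul_le_of_le_one_right hKD0 hβp
    linarith only [h1, h2, h3, hE, hG, hD]
  have hTQ : T / (A * Q) ≤ CT * Real.exp (-(β ^ (1 / 25 : ℝ) / 2)) := by
    rw [div_le_iff₀ (mul_pos hApos hQpos), hT, floorTail_eq hβ0, hCT, hQ, ← hnE]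
    have h1 : β * v ^ 2 / 2 = β ^ (1 / 25 : ℝ) / 2 := by rw [hβv2]
    rw [h1]
    -- `e^{−x}·2^{n/2}·√^n ≤ (e^{KA} 2^{n/2} e^{Z₀}) e^{−x} · (A · (√^n e^{−Z₀}))` since `e^{KA} A ≥ 1`
    have h2 : 1 ≤ Real.exp KA * A := by
      have := mul_le_mul_of_nonneg_left hAge (Real.exp_pos KA).le
      rwa [← Real.exp_add, add_neg_cancel, Real.exp_zero] at this
    have h3 : Real.exp (6 * toronZPE L (1 / 2) 0 0) * Real.exp (-(6 * toronZPE L (1 / 2) 0 0)) = 1 := by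
      rw [← Real.exp_add, add_neg_cancel, Real.exp_zero]
    have hn : (Fintype.card (Edge 3 L) * 3 : ℕ) = nE * 3 := by rw [hnE]
    rw [hn]
    have h4 : Real.exp KA * (2 : ℝ) ^ (((nE * 3 : ℕ) : ℝ) / 2) * Real.exp (6 * toronZPE L (1 / 2) 0 0) * Real.exp (-(β ^ (1 / 25 : ℝ) / 2)) *
        (A * (Real.sqrt (Real.pi / β) ^ (nE * 3) * Real.exp (-(6 * toronZPE L (1 / 2) 0 0)))) =
        (Real.exp KA * A) * (Real.exp (-(β ^ (1 / 25 : ℝ) / 2)) * ((2 : ℝ) ^ (((nE * 3 : ℕ) : ℝ) / 2) * Real.sqrt (Real.pi / β) ^ (nE * 3))) := by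
      calc _ = (Real.exp KA * A) * (Real.exp (-(β ^ (1 / 25 : ℝ) / 2)) * ((2 : ℝ) ^ (((nE * 3 : ℕ) : ℝ) / 2) * Real.sqrt (Real.pi / β) ^ (nE * 3))) *
          (Real.exp (6 * toronZPE L (1 / 2) 0 0) * Real.exp (-(6 * toronZPE L (1 / 2) 0 0))) := by ring
        _ = _ := by rw [h3, mul_one]
    rw [h4]
    exact le_mul_of_one_le_left (by positivity) h2
  have hMge : cM * s ^ (3 * nE) ≤ M := hcM β hβ1
  have hsβ : s ^ (3 * nE) = (β ^ (((3 * nE : ℕ) : ℝ) * (1 / 2)))⁻¹ := by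
    rw [hs, ← Real.rpow_natCast, ← Real.rpow_mul hβ0.le, ← Real.rpow_neg hβ0.le]; congr 1; ring
  obtain ⟨-, ha⟩ := hβa β hβa'
  obtain ⟨-, hb⟩ := hβb β hβb'
  have hBle : B ≤ K₂ * β ^ (-(1 / 10 : ℝ)) := by
    -- `B ≤ (e₁ + CT e^{−β^{1/25}/2}) / (cM s^{3nE}) = cM⁻¹ β^{3nE/2} (e₁ + CT e^{−β^{1/25}/2})`
    have h1 : B ≤ (e₁ + CT * Real.exp (-(β ^ (1 / 25 : ℝ) / 2))) / (cM * s ^ (3 * nE)) := by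
      rw [hB]
      exact div_le_div₀ (by positivity) (by linarith only [hTQ]) (by positivity) hMge
    refine h1.trans ?_
    rw [hsβ, he₁]
    have hpowpos : 0 < β ^ (((3 * nE : ℕ) : ℝ) * (1 / 2)) := Real.rpow_pos_of_pos hβ0 _
    rw [div_le_iff₀ (by positivity)]
    -- `β^{k}·e₁ ≤ e^{−4} β^{−1/10}` and `β^{k}·e^{−β^{1/25}/2} ≤ e^{−4} β^{−1/10}` from `ha`, `hb` with `k = 3nE/2 + 1/10`
    have hsplit : ∀ x : ℝ, β ^ (((3 * nE : ℕ) : ℝ) * (1 / 2) + 1 / 10) * x = β ^ (((3 * nE : ℕ) : ℝ) * (1 / 2)) * β ^ (1 / 10 : ℝ) * x := by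
      intro x; rw [Real.rpow_add hβ0]
    have hinv : β ^ (1 / 10 : ℝ) * β ^ (-(1 / 10 : ℝ)) = 1 := by rw [← Real.rpow_add hβ0]; norm_num
    have h2γ : 2 * γ * u ^ 2 = 2 * β ^ (1 / 30 : ℝ) := by rw [hγ, ← hγu2]; ring
    have ha' : β ^ (((3 * nE : ℕ) : ℝ) * (1 / 2)) * Real.exp (-(2 * γ * u ^ 2)) ≤ Real.exp (-4) * β ^ (-(1 / 10 : ℝ)) := by
      have h5 : Real.exp (-(2 * γ * u ^ 2)) ≤ Real.exp (-(β ^ (1 / 30 : ℝ) / 2)) := by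
        rw [h2γ, Real.exp_le_exp]; linarith only [Real.rpow_pos_of_pos hβ0 (1 / 30 : ℝ)]
      have h6 := mul_le_mul_of_nonneg_left h5 hpowpos.le
      have h7 : β ^ (((3 * nE : ℕ) : ℝ) * (1 / 2)) * Real.exp (-(β ^ (1 / 30 : ℝ) / 2)) =
          (β ^ (((3 * nE : ℕ) : ℝ) * (1 / 2) + 1 / 10) * Real.exp (-(β ^ (1 / 30 : ℝ) / 2))) * β ^ (-(1 / 10 : ℝ)) := by
        rw [hsplit]
        linear_combination -(β ^ (((3 * nE : ℕ) : ℝ) * (1 / 2)) * Real.exp (-(β ^ (1 / 30 : ℝ) / 2))) * hinv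
      rw [h7] at h6
      exact h6.trans (mul_le_mul_of_nonneg_right ha hβp0.le)
    have hb' : β ^ (((3 * nE : ℕ) : ℝ) * (1 / 2)) * Real.exp (-(β ^ (1 / 25 : ℝ) / 2)) ≤ Real.exp (-4) * β ^ (-(1 / 10 : ℝ)) := by
      have h7 : β ^ (((3 * nE : ℕ) : ℝ) * (1 / 2)) * Real.exp (-(β ^ (1 / 25 : ℝ) / 2)) =
          (β ^ (((3 * nE : ℕ) : ℝ) * (1 / 2) + 1 / 10) * Real.exp (-(β ^ (1 / 25 : ℝ) / 2))) * β ^ (-(1 / 10 : ℝ)) := by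
        rw [hsplit]
        linear_combination -(β ^ (((3 * nE : ℕ) : ℝ) * (1 / 2)) * Real.exp (-(β ^ (1 / 25 : ℝ) / 2))) * hinv
      rw [h7]
      exact mul_le_mul_of_nonneg_right hb hβp0.le
    calc Real.exp (-(2 * γ * u ^ 2)) + CT * Real.exp (-(β ^ (1 / 25 : ℝ) / 2))
        = (β ^ (((3 * nE : ℕ) : ℝ) * (1 / 2)) * Real.exp (-(2 * γ * u ^ 2)) + CT * (β ^ (((3 * nE : ℕ) : ℝ) * (1 / 2)) * Real.exp (-(β ^ (1 / 25 : ℝ) / 2)))) *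
            (β ^ (((3 * nE : ℕ) : ℝ) * (1 / 2)))⁻¹ := by field_simp
      _ ≤ (Real.exp (-4) * β ^ (-(1 / 10 : ℝ)) + CT * (Real.exp (-4) * β ^ (-(1 / 10 : ℝ)))) * (β ^ (((3 * nE : ℕ) : ℝ) * (1 / 2)))⁻¹ := by
          gcongr
      _ = K₂ * β ^ (-(1 / 10 : ℝ)) * (cM * (β ^ (((3 * nE : ℕ) : ℝ) * (1 / 2)))⁻¹) := by rw [hK₂]; field_simp
  have hB0 : 0 ≤ B :=
    div_nonneg (add_nonneg (Real.exp_pos _).le (div_nonneg (by rw [hT]; exact floorTail_nonneg hβ0 v) (mul_pos hApos hQpos).le)) hMpos.le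
  have hBhalf : B ≤ 1 / 2 := by
    refine hBle.trans ?_
    -- `K₂ β^{−1/10} ≤ 1/2` from `β ≥ (2K₂+1)^{10}`
    have h1 : β ^ (-(1 / 10 : ℝ)) ≤ (2 * K₂ + 1)⁻¹ := by
      have h2 : ((2 * K₂ + 1) ^ (10 : ℕ) : ℝ) ^ (-(1 / 10 : ℝ)) = (2 * K₂ + 1)⁻¹ := by
        rw [← Real.rpow_natCast, ← Real.rpow_mul (by positivity)]; norm_num
        exact Real.rpow_neg_one _
      rw [← h2]
      exact Real.rpow_le_rpow_of_nonpos (by positivity) hβK (by norm_num)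
    calc K₂ * β ^ (-(1 / 10 : ℝ)) ≤ K₂ * (2 * K₂ + 1)⁻¹ := mul_le_mul_of_nonneg_left h1 hK₂0
      _ ≤ 1 / 2 := by rw [← div_eq_mul_inv, div_le_iff₀ (by positivity)]; linarith only [hK₂0]
  -- ### assemble
  have hΛ0 : 0 ≤ idealFloorLevel L β := idealFloorLevel_nonneg β
  have h1B : Real.exp (-(2 * (K₂ * β ^ (-(1 / 10 : ℝ))))) ≤ 1 - B :=
    (Real.exp_le_exp.2 (by linarith only [hBle])).trans (Literature.NumberTheory.LFunctions.Nicolas.exp_neg_two_mul_le hB0 hBhalf)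
  show idealFloorLevel L β * Real.exp (-((K₁ + 2 * K₂) * β ^ (-(1 / 10 : ℝ)))) ≤ levelValue su2Rep L β 0
  calc idealFloorLevel L β * Real.exp (-((K₁ + 2 * K₂) * β ^ (-(1 / 10 : ℝ))))
      = idealFloorLevel L β * (Real.exp (-(K₁ * β ^ (-(1 / 10 : ℝ)))) * Real.exp (-(2 * (K₂ * β ^ (-(1 / 10 : ℝ)))))) := by
        rw [← Real.exp_add]; congr 1; congr 1; ring
    _ ≤ idealFloorLevel L β * ((P * Real.exp (-SU) * A) * (1 - B)) :=
        mul_le_mul_of_nonneg_left (mul_le_mul htol₁ h1B (Real.exp_pos _).le (by positivity)) hΛ0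
    _ = m * (1 - B) := by rw [hm_eq]; ring
    _ ≤ levelValue su2Rep L β 0 := hfloor'

/-! ## §2 ★★★ COARSE-UPPER(L) from the normalisation comparison and INNER alone -/

/-- ★★★ **The FLOOR clause from the normalisation comparison**: for `p < 1/10` and any `N : ℝ → ℝ` with, for every `ε > 0`, eventually
`N β · e^{−6Z₀(1/2)} ≤ Λ_id(β) · e^{εβ^{−p}}`: `ValleyFloorAt L (powScale p) (1/2) N`. [cite: Luscher1983, §3] -/
theorem valleyFloorAt_of_idealCmp_pow (hL : 2 ≤ L) {p : ℝ} (hp : p < 1 / 10) {N : ℝ → ℝ}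
    (hcmp : ∀ ε : ℝ, 0 < ε → ∃ β0 : ℝ, ∀ β : ℝ, β0 ≤ β →
      N β * Real.exp (-(6 * toronZPE L (1 / 2) 0 0)) ≤ idealFloorLevel L β * Real.exp (ε * powScale p β)) :
    ValleyFloorAt L (powScale p) (1 / 2) N := by
  obtain ⟨K, hK⟩ := vacuumFloorAt_ideal (L := L) hL
  refine valleyFloorAt_of_vacuumFloor hK (fun β => idealFloorLevel_nonneg β) (fun ε hε => ?_) hcmp
  -- `K β^{−1/10} ≤ ε β^{−p}` eventually (`p < 1/10`)
  obtain ⟨β0, h⟩ := eventually_rpow_dominates (a := 1 / 10 - p) (b := 0) (k := 0) (C := 4 * (|K| / ε)) (by linarith) (by linarith)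
  refine ⟨max β0 1, fun β hβ => ?_⟩
  obtain ⟨hβ1, h2⟩ := h β ((le_max_left _ _).trans hβ)
  have hβ0 : 0 < β := lt_of_lt_of_le one_pos hβ1
  rw [Real.rpow_zero, zero_mul, add_zero] at h2
  have h3 : |K| ≤ ε * β ^ (1 / 10 - p) := by
    have h6 : |K| / ε ≤ β ^ (1 / 10 - p) := by linarith only [h2, Real.rpow_nonneg hβ0.le (1 / 10 - p)]
    rw [div_le_iff₀ hε] at h6
    linarith only [h6]
  show K * β ^ (-(1 / 10 : ℝ)) ≤ ε * powScale p β
  rw [powScale, max_eq_left hβ1]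
  have h4 : K * β ^ (-(1 / 10 : ℝ)) ≤ |K| * β ^ (-(1 / 10 : ℝ)) := mul_le_mul_of_nonneg_right (le_abs_self K) (Real.rpow_nonneg hβ0.le _)
  refine h4.trans ?_
  have h5 : ε * β ^ (1 / 10 - p) * β ^ (-(1 / 10 : ℝ)) = ε * β ^ (-p) := by
    rw [mul_assoc, ← Real.rpow_add hβ0]; congr 1; congr 1; ring
  rw [← h5]
  exact mul_le_mul_of_nonneg_right h3 (Real.rpow_nonneg hβ0.le _)

/-- ★★★ **END TO END: COARSE-UPPER(L) ⇐ NORMALISATION COMPARISON + INNER.**  For `L ≥ 2`, `0 < p < 1/10`, `4p < q < 8/9`, `0 < r`, `2r < 1`, `0 < m`, `2r < q − m/2`: the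
comparison of lane B's explicit prefactor with the ideal level — `∀ ε > 0`, eventually `riccatiN L β (β^{−r}) (2β^{−q}) (β^{−m}) · e^{−6Z₀(1/2)} ≤ Λ_id(β) · e^{εβ^{−p}}` — and
`InnerNoIntruderOneOrbitAt L (β^{−p})` give COARSE-UPPER(L).  The k = 0 FLOOR is no longer a hypothesis. [cite: Luscher1983, §3] [cite: LuscherMunster1984, §2] -/
theorem coarseNoIntruderAt_of_idealCmp_pow (hL : 2 ≤ L) {p q r m : ℝ} (hp0 : 0 < p) (hp : p < 1 / 10) (hpq : 4 * p < q) (hq : q < 8 / 9)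
    (hr : 0 < r) (hr1 : 2 * r < 1) (hm : 0 < m) (hrq : 2 * r < q - m / 2)
    (hcmp : ∀ ε : ℝ, 0 < ε → ∃ β0 : ℝ, ∀ β : ℝ, β0 ≤ β →
      riccatiN L β (powScale r β) (2 * powScale q β) (powScale m β) * Real.exp (-(6 * toronZPE L (1 / 2) 0 0)) ≤
        idealFloorLevel L β * Real.exp (ε * powScale p β))
    (hI : InnerNoIntruderOneOrbitAt L (powScale p)) :
    ∀ k : ℕ, ∀ d : ℝ, d < levelGap k → ∃ lam0 : ℝ, 0 < lam0 ∧ ∀ lam : ℝ, 0 < lam → lam ≤ lam0 →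
      ∀ β : ℝ, InFemtoWindow lam β L →
        levelValue su2Rep L β k ≤ Real.exp (-(d * luscherLambda β L) / L) * levelValue su2Rep L β 0 :=
  coarseNoIntruderAt_of_floor_pow hp0 (by linarith) hpq hq hr hr1 hm hrq (valleyFloorAt_of_idealCmp_pow hL hp hcmp) hI

end Summit.QuantumFields.YangMills.Theorems.FemtoTransferGap

end
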